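import Summits.QuantumFields.YangMills.Theorems.PencilRigidityNPointIsotropyDegreeOneTie
import Summits.QuantumFields.YangMills.Theorems.CurvatureBoostCovariance.Negative.Unbundled
import HarnessLib

/-!
# `NPointIsotropy` — from tensors to `⁰𝒮`: the `β_k = 0`-frequently slice of the crux, outright

Support file for crux `stmt-QuantumFields-11686` (`PencilRigidity.NPointIsotropy`), line
`complex-rotation-bandlimit` (generation 5, wave 2), helper stub `betaZeroPlanarInvariant`.

**The density hypothesis (H).** Every off-diagonal test function `F ∈ ⁰𝒮ₙ = ⁰𝒮((ℝ⁴)ⁿ)` lies in the closure of the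
`ℂ`-span of the off-diagonal REAL PRODUCT TENSORS `f₀ ⊗ ⋯ ⊗ f_{n-1}` (`fᵢ ∈ 𝓢(ℝ⁴, ℝ)` with pairwise disjoint supports,
complexified) — proved in parallel by the sibling stubs of the wave and taken here as an explicit hypothesis.

**Statements.**

* `eqOn_offDiagonal_of_eqOn_tensors`: under (H), two continuous linear functionals on `𝓢((ℝ⁴)ⁿ, ℂ)` that agree on
  off-diagonal real product tensors agree on all of `⁰𝒮ₙ` (`ContinuousLinearMap.eqOn_closure_span`).
* `planarInvariant_of_tensors`: under (H), a one-species Schwinger family `S₁` that is invariant on off-diagonal real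
  product tensors of positive degree under every linear isometry of `ℝ⁴` satisfies the crux's conclusion
  `PlanarInvariant S₁` (degree `0` is trivial: `Fin 0 → ℝ⁴` is a point; positive degree: apply the previous item
  to `S₁ n ∘ (R · )` and `S₁ n`).
* `tie_unique_offDiagonal`: under (H), two families tied to the same Wilson scheme agree on ALL of `⁰𝒮ₙ`, `n ≠ 0`
  (the tie pins `S₁` on `⁰𝒮`, not only on tensors: `tie_unique` + the first item).
* `betaZeroPlanarInvariant` (registered): under (H), a family tied to the curvature channel of Wilson's lattice
  Yang–Mills along a scheme with `β_k = 0` for infinitely many `k` satisfies `PlanarInvariant S₁` OUTRIGHT — the landed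
  `tie_conclusion_on_tensors_of_beta_zero` gives the invariance on off-diagonal real tensors of positive degree under
  every linear isometry, and `planarInvariant_of_tensors` lifts it to `⁰𝒮`. No reflection positivity, spectral cone,
  translation invariance or residual hypothesis enters: the `β_k = 0`-frequently slice of scheme space carries no
  counterexample to the crux.
[folklore]
-/

noncomputable section

namespace Summit.QuantumFields.YangMills.Theorems.NPointIsotropy.ComplexRotationBandlimit

open scoped SchwartzMap
open MeasureTheory Filter Topology
open Literature.MathematicalPhysics.QuantumLattice Literature.MathematicalPhysics.AQFT
  Literature.MathematicalPhysics.QuantumFieldTheory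
open Summit.QuantumFields.YangMills.Theorems.NPointIsotropy.Negative (E4)
open Summit.QuantumFields.YangMills.Theorems.CurvatureBoostCovariance.Negative (Tie PlanarInvariant tie_unique)

/-! ## From tensors to `⁰𝒮` through the density hypothesis -/

/-- **Agreement on off-diagonal real product tensors is agreement on `⁰𝒮`** (given the density hypothesis (H)): two
continuous linear functionals on `𝓢((ℝ⁴)ⁿ, ℂ)` that agree on the off-diagonal real product tensors agree on the
closure of their span, which by (H) contains every off-diagonal test function. [folklore] -/
theorem eqOn_offDiagonal_of_eqOn_tensors
    (H : ∀ (n : ℕ) (F : 𝓢((Fin n → E4), ℂ)), IsOffDiagonal F →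
      F ∈ closure (Submodule.span ℂ {P : 𝓢((Fin n → E4), ℂ) | ∃ f : Fin n → 𝓢(E4, ℝ),
        IsTensorOf P (fun i => ofRealTest (f i)) ∧ IsOffDiagonal P} : Set (𝓢((Fin n → E4), ℂ))))
    {n : ℕ} (A B : 𝓢((Fin n → E4), ℂ) →L[ℂ] ℂ)
    (hAB : ∀ (f : Fin n → 𝓢(E4, ℝ)) (P : 𝓢((Fin n → E4), ℂ)),
      IsTensorOf P (fun i => ofRealTest (f i)) → IsOffDiagonal P → A P = B P)
    (F : 𝓢((Fin n → E4), ℂ)) (hF : IsOffDiagonal F) : A F = B F :=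
  ContinuousLinearMap.eqOn_closure_span (fun P hP => by
    obtain ⟨f, hP, hP'⟩ := hP
    exact hAB f P hP hP') (H n F hF)

/-- **`PlanarInvariant` from invariance on tensors** (given the density hypothesis (H)): a one-species Schwinger
family on `ℝ⁴` that is invariant on off-diagonal real product tensors of positive degree under every linear isometry
of `ℝ⁴` is invariant on all of `⁰𝒮` under the rotations of the `(x₀,x₁)`-plane (indeed under every linear isometry):
degree `0` because `Fin 0 → ℝ⁴` is a one-point space, positive degree by `eqOn_offDiagonal_of_eqOn_tensors` applied
to the functionals `S₁ n ∘ (R · )` and `S₁ n`. [folklore] -/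
theorem planarInvariant_of_tensors
    (H : ∀ (n : ℕ) (F : 𝓢((Fin n → E4), ℂ)), IsOffDiagonal F →
      F ∈ closure (Submodule.span ℂ {P : 𝓢((Fin n → E4), ℂ) | ∃ f : Fin n → 𝓢(E4, ℝ),
        IsTensorOf P (fun i => ofRealTest (f i)) ∧ IsOffDiagonal P} : Set (𝓢((Fin n → E4), ℂ))))
    (S₁ : SchwingerFamily E4)
    (h : ∀ (R : E4 ≃ₗᵢ[ℝ] E4) (n : ℕ), n ≠ 0 → ∀ (f : Fin n → 𝓢(E4, ℝ)) (F : 𝓢((Fin n → E4), ℂ)),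
      IsTensorOf F (fun i => ofRealTest (f i)) → IsOffDiagonal F → S₁ n (linActMulti R F) = S₁ n F) :
    PlanarInvariant S₁ := by
  intro R _ _ _ n F hF
  obtain rfl | hn := eq_or_ne n 0
  · rw [DegreeLeTwo.linActMulti_fin_zero]
  · exact eqOn_offDiagonal_of_eqOn_tensors H ((S₁ n).comp (linActMulti R)) (S₁ n)
      (fun f P hP hP' => h R n hn f P hP hP') F hF

section Tied

variable {G : Type} [Group G] [TopologicalSpace G] [IsTopologicalGroup G] [CompactSpace G]
  [MeasurableSpace G] [BorelSpace G]

/-- **The tie pins `S₁` on all of `⁰𝒮`** (given the density hypothesis (H)): two families tied to the same Wilson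
scheme `(r, sch)` agree on every off-diagonal test function of positive degree — on tensors by uniqueness of limits
(`tie_unique`), on `⁰𝒮` by continuity and density. [folklore] -/
theorem tie_unique_offDiagonal
    (H : ∀ (n : ℕ) (F : 𝓢((Fin n → E4), ℂ)), IsOffDiagonal F →
      F ∈ closure (Submodule.span ℂ {P : 𝓢((Fin n → E4), ℂ) | ∃ f : Fin n → 𝓢(E4, ℝ),
        IsTensorOf P (fun i => ofRealTest (f i)) ∧ IsOffDiagonal P} : Set (𝓢((Fin n → E4), ℂ))))
    {r : LatticeRep G} {sch : SpeciesScheme (YMSpecies G)} {S₁ S₁' : SchwingerFamily E4}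
    (h₁ : Tie r sch S₁) (h₁' : Tie r sch S₁') {n : ℕ} (hn : n ≠ 0) (F : 𝓢((Fin n → E4), ℂ))
    (hF : IsOffDiagonal F) : S₁ n F = S₁' n F :=
  eqOn_offDiagonal_of_eqOn_tensors H (S₁ n) (S₁' n) (fun f P hP hP' => tie_unique h₁ h₁' hn f P hP hP') F hF

end Tied

/-- **The `β_k = 0`-frequently slice of the crux, outright** (registered helper stub `betaZeroPlanarInvariant` of
stmt-QuantumFields-11686): given the density hypothesis (H), every one-species Schwinger family tied to the curvature
channel of Wilson's lattice Yang–Mills theory (any compact `G`, any lattice representation `r`) along a scheme with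
`β_k = 0` for infinitely many `k` satisfies the crux's conclusion `PlanarInvariant S₁` — invariance on `⁰𝒮` under
every determinant-one isometry fixing `e₂, e₃`, in every degree. On off-diagonal real tensors of positive degree this
is the landed `tie_conclusion_on_tensors_of_beta_zero` (for EVERY linear isometry); `planarInvariant_of_tensors`
lifts it to `⁰𝒮`. [folklore] -/
theorem betaZeroPlanarInvariant : (∀ (n : ℕ) (F : SchwartzMap (Fin n → EuclideanSpace ℝ (Fin 4)) ℂ), Literature.MathematicalPhysics.AQFT.IsOffDiagonal F → F ∈ closure (Submodule.span ℂ {P : SchwartzMap (Fin n → EuclideanSpace ℝ (Fin 4)) ℂ | ∃ f : Fin n → SchwartzMap (EuclideanSpace ℝ (Fin 4)) ℝ, Literature.MathematicalPhysics.QuantumLattice.IsTensorOf P (fun i => Literature.MathematicalPhysics.QuantumLattice.ofRealTest (f i)) ∧ Literature.MathematicalPhysics.AQFT.IsOffDiagonal P} : Set (SchwartzMap (Fin n → EuclideanSpace ℝ (Fin 4)) ℂ))) → ∀ (G : Type) [Group G] [TopologicalSpace G] [IsTopologicalGroup G] [CompactSpace G] [MeasurableSpace G] [BorelSpace G] (r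 : Literature.MathematicalPhysics.QuantumFieldTheory.LatticeRep G) (sch : Literature.MathematicalPhysics.QuantumFieldTheory.SpeciesScheme (Literature.MathematicalPhysics.QuantumFieldTheory.YMSpecies G)) (S₁ : Literature.MathematicalPhysics.QuantumLattice.SchwingerFamily (EuclideanSpace ℝ (Fin 4))), Summit.QuantumFields.YangMills.Theorems.CurvatureBoostCovariance.Negative.Tie r sch S₁ → (∃ᶠ k in Filter.atTop, sch.β k = 0) → Summit.QuantumFields.YangMills.Theorems.CurvatureBoostCovariance.Negative.PlanarInvariant S₁ := by
  intro H G _ _ _ _ _ _ r sch S₁ htie hβ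
  exact planarInvariant_of_tensors H S₁ fun R n hn f F hF hF' =>
    tie_conclusion_on_tensors_of_beta_zero r sch hβ htie R hn f F hF hF'

end Summit.QuantumFields.YangMills.Theorems.NPointIsotropy.ComplexRotationBandlimit

end
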